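import Literature.Probability.Distributions.CharFunInversion
import Literature.Analysis.FunctionSpaces.UniformRandomWalkDensityPlane
import Literature.Analysis.FunctionSpaces.BesselJProofs
import Mathlib.MeasureTheory.Constructions.HaarToSphere
import HarnessLib

/-!
# Fourier inversion in the plane for rotation-invariant characteristic functions (Hankel form)

A sequel of `CharFunInversion.lean` specialised to the plane `ℂ ≅ ℝ²`. Let `μ` be a finite Borel
measure on `ℂ` whose characteristic function is RADIAL, `charFun μ ξ = φ(‖ξ‖)` for a continuous
real profile `φ`, with `r φ(r)` integrable on `(0, ∞)`. Then:

* `integrable_charFun_of_radial` — `charFun μ ∈ L¹(ℂ)` (polar coordinates), so the inversion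
  theorem applies: `μ = f_μ · Lebesgue`, `f_μ = fourierDensity μ` continuous
  (`eq_withDensity_fourierDensity_of_charFun_radial`);
* `fourierDensity_eq_hankel_of_charFun_radial` — **the order-`0` Hankel inversion formula**
  `f_μ(z) = (2π)⁻¹ ∫₀^∞ r φ(r) J₀(r‖z‖) dr` for every `z` (inversion formula, polar coordinates in
  the frequency plane, the angular integral being `∫₀^{2π} e^{i r‖z‖ cos θ} dθ = 2π J₀(r‖z‖)`,
  `Literature.Analysis.FunctionSpaces.integral_cexp_I_mul_inner_unitStep`); in particular `f_μ`
  is radial;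
* `map_norm_eq_withDensity_of_charFun_radial` — the law of `‖X‖`, `X ∼ μ`, is
  `2πx f_μ(x) dx` on `(0, ∞)`.

This is the classical Fourier–Bessel (Hankel) transform pair for radial functions in `ℝ²`
(e.g. Stein–Weiss, *Introduction to Fourier Analysis on Euclidean Spaces*, Ch. IV Thm 3.3 with
`n = 2`), in the probabilists' normalisation; Kluyver's representation of the densities of uniform
random walks (`Literature.Analysis.FunctionSpaces.fourierDensity_uniformWalkLaw_eq`, `φ = J₀ⁿ`) is
the motivating instance.

## References

* E. M. Stein, G. Weiss, *Introduction to Fourier Analysis on Euclidean Spaces*, Princeton 1971,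
  Ch. IV, Thm 3.3 (Fourier transform of radial functions via Bessel functions); folklore in this
  form.
-/

noncomputable section

open _root_.MeasureTheory _root_.Set _root_.Real _root_.Complex _root_.Filter
open scoped ENNReal RealInnerProductSpace
open Literature.Analysis.FunctionSpaces

namespace Literature.Probability.Distributions

variable {μ : Measure ℂ} {φ : ℝ → ℝ}

/-- A radial characteristic function with `r φ(r) ∈ L¹(0, ∞)` is integrable on the plane (polar
coordinates). [folklore] -/
theorem integrable_charFun_of_radial (hμ : ∀ ξ : ℂ, charFun μ ξ = φ ‖ξ‖)
    (hφ : IntegrableOn (fun r : ℝ => r * φ r) (Ioi 0)) : Integrable (charFun μ) := by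
  have h2 : Integrable (fun ξ : ℂ => φ ‖ξ‖) := by
    refine (integrable_fun_norm_addHaar (volume : Measure ℂ) (f := φ)).2 ?_
    simpa only [Complex.finrank_real_complex, Nat.add_one_sub_one, pow_one, smul_eq_mul] using hφ
  have h1 : charFun μ = fun ξ : ℂ => ((φ ‖ξ‖ : ℝ) : ℂ) := funext hμ
  rw [h1]
  exact h2.ofReal

/-- Hence the inversion theorem applies: `μ = f_μ · Lebesgue`. [folklore] -/
theorem eq_withDensity_fourierDensity_of_charFun_radial [IsFiniteMeasure μ]
    (hμ : ∀ ξ : ℂ, charFun μ ξ = φ ‖ξ‖) (hφ : IntegrableOn (fun r : ℝ => r * φ r) (Ioi 0)) :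
    μ = volume.withDensity (fun z => ENNReal.ofReal (fourierDensity μ z)) :=
  eq_withDensity_fourierDensity_of_integrable_charFun (integrable_charFun_of_radial hμ hφ)

/-- …with a continuous density. [folklore] -/
theorem continuous_fourierDensity_of_charFun_radial [IsFiniteMeasure μ]
    (hμ : ∀ ξ : ℂ, charFun μ ξ = φ ‖ξ‖) (hφ : IntegrableOn (fun r : ℝ => r * φ r) (Ioi 0)) :
    Continuous (fourierDensity μ) :=
  continuous_fourierDensity (integrable_charFun_iff.1 (integrable_charFun_of_radial hμ hφ))

/-- The angular integral over `(−π, π)`: `∫ e^{i(a cos θ + b sin θ)} dθ = 2π J₀(‖a + bi‖)`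
(periodic shift of `integral_cexp_I_mul_inner_unitStep`). [folklore] -/
private theorem angularIntegral_Ioo (ξ : ℂ) :
    ∫ θ in Ioo (-π) π, cexp (I * ((ξ.re * Real.cos θ + ξ.im * Real.sin θ : ℝ) : ℂ)) =
      2 * π * besselJ 0 ‖ξ‖ := by
  set F : ℝ → ℂ := fun θ => cexp (I * ((ξ.re * Real.cos θ + ξ.im * Real.sin θ : ℝ) : ℂ)) with hF
  have hper : Function.Periodic F (2 * π) := fun θ => by
    simp only [hF, Real.cos_add_two_pi, Real.sin_add_two_pi]
  rw [← integral_Ioc_eq_integral_Ioo, ← intervalIntegral.integral_of_le (by linarith [pi_pos])]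
  have h := hper.intervalIntegral_add_eq (-π) 0
  rw [zero_add, show -π + 2 * π = π by ring] at h
  change ∫ θ in (-π)..π, F θ = _
  rw [h]
  exact integral_cexp_I_mul_inner_unitStep ξ

/-- Pointwise form of the polar-coordinate integrand. [folklore] -/
private theorem polar_integrand_eq' (z : ℂ) (φ : ℝ → ℝ) {p : ℝ × ℝ} (hp : 0 < p.1) :
    p.1 • (cexp (-((⟪(p.1 : ℂ) * (Real.cos p.2 + Real.sin p.2 * I), z⟫ : ℝ) : ℂ) * I) *
        ((φ ‖(p.1 : ℂ) * (Real.cos p.2 + Real.sin p.2 * I)‖ : ℝ) : ℂ)) =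
      ((p.1 * φ p.1 : ℝ) : ℂ) *
        cexp (I * (((-(p.1 : ℂ) * z).re * Real.cos p.2 + (-(p.1 : ℂ) * z).im * Real.sin p.2 :
          ℝ) : ℂ)) := by
  have hnorm : ‖(p.1 : ℂ) * (Real.cos p.2 + Real.sin p.2 * I)‖ = p.1 := by
    rw [norm_mul, Complex.norm_real, Real.norm_of_nonneg hp.le, Complex.ofReal_cos,
      Complex.ofReal_sin, Complex.norm_cos_add_sin_mul_I, mul_one]
  have hinner : (⟪(p.1 : ℂ) * (Real.cos p.2 + Real.sin p.2 * I), z⟫ : ℝ) =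
      p.1 * (z.re * Real.cos p.2 + z.im * Real.sin p.2) := by
    simp only [Complex.inner, map_mul, Complex.conj_ofReal, map_add, Complex.conj_I,
      Complex.mul_re, Complex.mul_im, Complex.ofReal_re, Complex.ofReal_im, Complex.add_re,
      Complex.add_im, Complex.neg_re, Complex.neg_im, Complex.I_re, Complex.I_im, mul_neg,
      mul_zero, mul_one, zero_mul, sub_zero, add_zero, zero_add, neg_zero, sub_neg_eq_add]
    ring
  rw [hnorm, hinner, Complex.real_smul]
  have h2 : ((-(p.1 : ℂ) * z).re * Real.cos p.2 + (-(p.1 : ℂ) * z).im * Real.sin p.2 : ℝ) =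
      -(p.1 * (z.re * Real.cos p.2 + z.im * Real.sin p.2)) := by
    simp only [neg_mul, Complex.neg_re, Complex.neg_im, Complex.mul_re, Complex.mul_im,
      Complex.ofReal_re, Complex.ofReal_im, zero_mul, sub_zero, add_zero]
    ring
  rw [h2]
  push_cast
  ring_nf

/-- **Hankel inversion of order `0` in the plane**: if `charFun μ ξ = φ(‖ξ‖)` with `φ`
continuous and `r φ(r) ∈ L¹(0,∞)`, then for every `z`,
`f_μ(z) = (2π)⁻¹ ∫₀^∞ r φ(r) J₀(r‖z‖) dr`. [folklore] -/
theorem fourierDensity_eq_hankel_of_charFun_radial (hμ : ∀ ξ : ℂ, charFun μ ξ = φ ‖ξ‖)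
    (hφc : Continuous φ) (hφ : IntegrableOn (fun r : ℝ => r * φ r) (Ioi 0)) (z : ℂ) :
    fourierDensity μ z = (2 * π)⁻¹ * ∫ r in Ioi (0 : ℝ), r * besselJ 0 (r * ‖z‖) * φ r := by
  rw [fourierDensity_eq_integral_charFun, Complex.finrank_real_complex]
  have key : ∫ t : ℂ, cexp (-(⟪t, z⟫ : ℝ) * I) * charFun μ t =
      ((2 * π * ∫ r in Ioi (0 : ℝ), r * besselJ 0 (r * ‖z‖) * φ r : ℝ) : ℂ) := by
    simp_rw [hμ]
    rw [← Complex.integral_comp_polarCoord_symm,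
      show polarCoord.target = Ioi (0 : ℝ) ×ˢ Ioo (-π) π from rfl]
    simp only [Complex.polarCoord_symm_apply]
    rw [setIntegral_congr_fun (measurableSet_Ioi.prod measurableSet_Ioo)
      (fun p hp => polar_integrand_eq' z φ (mem_Ioi.1 hp.1))]
    have hint : IntegrableOn (fun p : ℝ × ℝ => ((p.1 * φ p.1 : ℝ) : ℂ) *
        cexp (I * (((-(p.1 : ℂ) * z).re * Real.cos p.2 + (-(p.1 : ℂ) * z).im * Real.sin p.2 :
          ℝ) : ℂ))) (Ioi (0 : ℝ) ×ˢ Ioo (-π) π) (volume.prod volume) := by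
      have hg : Integrable (fun p : ℝ × ℝ => ‖p.1 * φ p.1‖ * (1 : ℝ))
          ((volume.restrict (Ioi (0 : ℝ))).prod (volume.restrict (Ioo (-π) π))) :=
        hφ.norm.mul_prod (integrable_const (1 : ℝ))
      rw [Measure.prod_restrict] at hg
      have hc1 : Continuous fun p : ℝ × ℝ => ((p.1 * φ p.1 : ℝ) : ℂ) :=
        Complex.continuous_ofReal.comp (continuous_fst.mul (hφc.comp continuous_fst))
      have hc2 : Continuous fun p : ℝ × ℝ => cexp (I * (((-(p.1 : ℂ) * z).re * Real.cos p.2 +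
          (-(p.1 : ℂ) * z).im * Real.sin p.2 : ℝ) : ℂ)) := by fun_prop
      refine Integrable.mono' hg (hc1.mul hc2).aestronglyMeasurable ?_
      refine Filter.Eventually.of_forall fun p => le_of_eq ?_
      rw [norm_mul, Complex.norm_real, mul_comm I, Complex.norm_exp_ofReal_mul_I]
    rw [show (volume : Measure (ℝ × ℝ)) = volume.prod volume from rfl, setIntegral_prod _ hint]
    have hinner : ∀ r : ℝ, ∫ θ in Ioo (-π) π, ((r * φ r : ℝ) : ℂ) *
        cexp (I * (((-(r : ℂ) * z).re * Real.cos θ + (-(r : ℂ) * z).im * Real.sin θ : ℝ) : ℂ)) =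
        ((r * φ r * (2 * π * besselJ 0 (r * ‖z‖)) : ℝ) : ℂ) := by
      intro r
      rw [integral_const_mul, angularIntegral_Ioo]
      push_cast
      rw [norm_mul, norm_neg, Complex.norm_real, Real.norm_eq_abs]
      rcases le_or_gt 0 r with hr | hr
      · rw [abs_of_nonneg hr]
      · rw [abs_of_neg hr, show -r * ‖z‖ = -(r * ‖z‖) by ring, besselJ_neg]; simp
    simp_rw [hinner]
    have e : ∫ r in Ioi (0 : ℝ), ((r * φ r * (2 * π * besselJ 0 (r * ‖z‖)) : ℝ) : ℂ) =
        ((∫ r in Ioi (0 : ℝ), r * φ r * (2 * π * besselJ 0 (r * ‖z‖)) : ℝ) : ℂ) :=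
      integral_ofReal
    rw [e]
    congr 1
    rw [← integral_const_mul]
    refine setIntegral_congr_fun measurableSet_Ioi fun r _ => ?_
    ring
  rw [key, Complex.ofReal_re, ← mul_assoc]
  congr 1
  have hπ : (π : ℝ) ≠ 0 := pi_ne_zero
  field_simp

/-- In particular `f_μ` is radial. [folklore] -/
theorem fourierDensity_ofReal_norm_of_charFun_radial (hμ : ∀ ξ : ℂ, charFun μ ξ = φ ‖ξ‖)
    (hφc : Continuous φ) (hφ : IntegrableOn (fun r : ℝ => r * φ r) (Ioi 0)) (z : ℂ) :
    fourierDensity μ (‖z‖ : ℂ) = fourierDensity μ z := by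
  rw [fourierDensity_eq_hankel_of_charFun_radial hμ hφc hφ,
    fourierDensity_eq_hankel_of_charFun_radial hμ hφc hφ, Complex.norm_real, norm_norm]

/-- **The law of `‖X‖`** for `X ∼ μ` with radial characteristic function: density
`2πx f_μ(x)` on `(0, ∞)`. [folklore] -/
theorem map_norm_eq_withDensity_of_charFun_radial [IsFiniteMeasure μ]
    (hμ : ∀ ξ : ℂ, charFun μ ξ = φ ‖ξ‖) (hφc : Continuous φ)
    (hφ : IntegrableOn (fun r : ℝ => r * φ r) (Ioi 0)) :
    μ.map (fun z : ℂ => ‖z‖) =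
      (volume.restrict (Ioi (0 : ℝ))).withDensity
        (fun x => ENNReal.ofReal (2 * π * x * fourierDensity μ x)) := by
  set F : ℝ → ℝ := fun x => fourierDensity μ x with hF
  have hint := integrable_charFun_iff.1 (integrable_charFun_of_radial hμ hφ)
  have hFc : Continuous F :=
    (continuous_fourierDensity_of_charFun_radial hμ hφ).comp Complex.continuous_ofReal
  have hF0 : ∀ x, 0 ≤ F x := fun x => fourierDensity_nonneg hint _
  haveI : IsFiniteMeasure (μ.map fun z : ℂ => ‖z‖) :=
    Measure.isFiniteMeasure_map μ _
  refine Measure.ext_of_Ioc _ _ fun a b hab => ?_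
  have hIntab : IntegrableOn (fun x => x * F x) (Ioc a b) :=
    ((continuous_id.mul hFc).continuousOn.integrableOn_compact isCompact_Icc).mono_set
      Ioc_subset_Icc_self
  rw [withDensity_apply _ measurableSet_Ioc, Measure.restrict_restrict measurableSet_Ioc]
  have hR : ∫⁻ x in Ioc a b ∩ Ioi 0, ENNReal.ofReal (2 * π * x * F x) =
      ENNReal.ofReal (∫ x in Ioc a b ∩ Ioi 0, 2 * π * x * F x) := by
    rw [ofReal_integral_eq_lintegral_ofReal]
    · refine ((hIntab.mono_set inter_subset_left).const_mul (2 * π)).congr ?_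
      exact Filter.Eventually.of_forall fun x => by ring
    · refine ae_restrict_of_forall_mem (measurableSet_Ioc.inter measurableSet_Ioi) fun x hx => ?_
      have : 0 < x := hx.2
      have := hF0 x
      positivity
  rw [hR, Measure.map_apply continuous_norm.measurable measurableSet_Ioc]
  conv_lhs => rw [eq_withDensity_fourierDensity_of_charFun_radial hμ hφ]
  rw [withDensity_apply _ (measurableSet_Ioc.preimage continuous_norm.measurable)]
  set G : ℝ → ℝ := (Ioc a b).indicator fun x => F x with hG
  have hGm : ∀ z : ℂ, ((fun w : ℂ => ‖w‖) ⁻¹' Ioc a b).indicator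
      (fun w => ENNReal.ofReal (fourierDensity μ w)) z = ENNReal.ofReal (G ‖z‖) := by
    intro z
    by_cases hz : ‖z‖ ∈ Ioc a b
    · rw [indicator_of_mem (show z ∈ (fun w : ℂ => ‖w‖) ⁻¹' Ioc a b from hz), hG,
        indicator_of_mem hz, ← fourierDensity_ofReal_norm_of_charFun_radial hμ hφc hφ z]
    · rw [indicator_of_notMem (show z ∉ (fun w : ℂ => ‖w‖) ⁻¹' Ioc a b from hz), hG,
        indicator_of_notMem hz, ENNReal.ofReal_zero]
  rw [← lintegral_indicator (measurableSet_Ioc.preimage continuous_norm.measurable)]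
  simp_rw [hGm]
  have hyG : (fun y : ℝ => y * G y) = (Ioc a b).indicator fun y => y * F y := by
    funext y; simp only [hG, Set.indicator_apply]; split_ifs <;> simp
  have hGint : Integrable (fun z : ℂ => G ‖z‖) := by
    refine (integrable_fun_norm_addHaar (volume : Measure ℂ) (f := G)).2 ?_
    simp only [Complex.finrank_real_complex, Nat.add_one_sub_one, pow_one, smul_eq_mul]
    rw [hyG, integrableOn_indicator_iff measurableSet_Ioc]
    exact hIntab.mono_set inter_subset_left
  have hG0 : ∀ y, 0 ≤ G y := fun y => by
    simp only [hG, Set.indicator_apply]; split_ifs <;> simp [hF0]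
  rw [← ofReal_integral_eq_lintegral_ofReal hGint (Filter.Eventually.of_forall fun z => hG0 _)]
  congr 1
  rw [integral_fun_norm_addHaar (volume : Measure ℂ) G, Complex.finrank_real_complex,
    Measure.real, Complex.volume_ball]
  simp only [ENNReal.ofReal_one, one_pow, one_mul, ENNReal.coe_toReal, NNReal.coe_real_pi,
    Nat.add_one_sub_one, pow_one, smul_eq_mul, nsmul_eq_mul, Nat.cast_ofNat]
  rw [hyG, integral_indicator measurableSet_Ioc, Measure.restrict_restrict measurableSet_Ioc,
    ← integral_const_mul, ← integral_const_mul]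
  refine setIntegral_congr_fun ((measurableSet_Ioc (a := a) (b := b)).inter
    (measurableSet_Ioi (a := (0 : ℝ)))) fun x _ => ?_
  ring

end Literature.Probability.Distributions

end
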